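import Summits.ABC.IUTFork.Repair.RHRound4ConstraintFacesEven
import Summits.ABC.IUTFork.Repair.RHRound4ConstraintRequirementsD
import HarnessLib

/-!
# R-H ROUND 4 — KERNEL FACES for the EVEN sheets, part 2: sheet V4B's requirement words BY NAME over abc-iut-L5-t8's part D (★ p541424) —
# the INERTNESS LEMMA `V4B_inertEven` PROVED for every orientation, the top-label law's constant, and A6 reduced to its synchronisation clause

abc-iut cell, rung LADDER-ABC:A2.RESCUE.H; seat abc-iut-rh2-w-1 (GEN 6; KEY `wake/KEY-abc-iut-rh2-w-1-R4FACE-EVEN.md`, abc-iut-rh-lead g5 under director-abc g6-D15 (4);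
referee rh-ref-2). Companion of part 1 `Repair/RHRound4ConstraintFacesEven.lean` (★ p542823: §V2 / §V4 + V4B over an abstract involution / §V6), split off for the
400-line rule (D-0064). abc-iut-L5-t8's part D `Repair/RHRound4ConstraintRequirementsD.lean` (★ p541424; sheet V4B 23dbb0dfaaa08765 §(a) words A1–A7) landed the V4B
names while part 1 was in flight and asked (STATUS 15:02:13Z) «the V4B INERTNESS LEMMA is typed here as the Prop `V4B_inertEven l O` over an explicit orientation structure
`OrientedLabels l` … prove THAT statement in your faces file, nothing to restate». This file does exactly that, BY NAME:
* (γ) `V4B_inertEven_holds`: for EVERY `O : OrientedLabels l`, `V4B_inertEven l O` — the oriented sum over `ZMod l ∖ 0` of `ν·col` for an even column equals the half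
  sum along `O` with the pushed-forward weights `ν(ι i) + ν(−ι i)`. Key step `orientedCover_bijective`: the map `Fin l⋆ ⊕ Fin l⋆ → {t ≠ 0}`, `inl i ↦ ι i`,
  `inr i ↦ −ι i`, is a BIJECTION — surjective by the field `covers`, injective by counting (`2·⌊(l−1)/2⌋ ≤ l − 1 = #(ZMod l ∖ 0)`), so the injectivity of `ι` that part
  D deliberately left out of the structure is FORCED by its three fields.
* (α) `lawConstant_top`: L5-t8's top-label law `LabelLaw.top` (the law at which `V4B_measureResidual`'s door `V4_B6_labelLawDoor` sits) has constant `2l/(l⋆−1)`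
  (`= 4l/(l−3)`, FENCE minimum) — part 1's `lawConstant_of_top` BY NAME.
* (β) `hasOrbitCount_bot` (the trivial label symmetry has exactly `n` orbits on `n` labels), `stabilizer_bot_eq_bot`, and `V4B_conjSyncWithoutPM_iff`:
  `V4B_conjSyncWithoutPM n ConjSync ↔ 2 ≤ n ∧ ConjSync` — A6's orbit-count, free-action and network conjuncts are DISCHARGED at the trivial group, so, exactly as
  the sheet says, «the synchronisation clause is the whole content» (a PARAMETER nothing here inhabits); and `not_isPretransitive_of_conjSyncWithoutPM`.
HONEST FRAMING / GUARDS: PROOF-ONLY (0 definitions, 0 `Prop` facts, no `instance` / `notation` / `macro`; no Literature fact — FROZEN FACT-LIST f75a60bac22efdb6); finite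
algebra about OUR typed label bookkeeping and L5-t8's claim-tagged requirement `Prop`s; «orientation alone is count-neutral» is a kernel identity between typed
statements, never a claim about [IUTchI–III]; located ≠ adjudicated; typed ≠ proved ≠ inhabited; no side on [IUTchIII] Cor 3.12 / Rmk 3.9.3 / [IUTchI] Def 6.1 or on
any author (D-0045); nothing here asserts that abc is proved or refuted. [claim: Mochizuki2012, status: disputed] for every IUT locution.
[cite: Mochizuki2012, IUTchI Def. 6.1 (ii) p. 156–157, Prop. 6.8 p. 168; IUTchII Cor. 2.5 (ii) p. 72, Cor. 3.5 (i) p. 94; IUTchIII Rmk. 3.9.3 p. 119–120]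
-/

noncomputable section

open Finset

namespace Summit.ABC.IUTFork.Repair.RH.Round4ConstraintFacesEven

open Summit.ABC.IUTFork.Repair.RH.Round4ConstraintRequirements

/-! ## §V4B (γ). The inertness lemma `V4B_inertEven` for every orientation -/

section Inert

variable {l : ℕ} [NeZero l]

/-- **The orientation covers `ZMod l ∖ 0` EXACTLY ONCE up to sign**: for `O : OrientedLabels l` the map `Fin l⋆ ⊕ Fin l⋆ → {t : ZMod l // t ≠ 0}`, `inl i ↦ ι i`,
`inr i ↦ −ι i`, is a bijection — surjective by `covers`, and then injective because `2·⌊(l−1)/2⌋ ≤ l − 1 = #(ZMod l ∖ 0)`. (So `ι` is injective although part D does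
not require it: the three fields force it.) [folklore] -/
theorem orientedCover_bijective (O : OrientedLabels l) :
    Function.Bijective (Sum.elim (fun i => (⟨O.ι i, O.ne_zero i⟩ : {t : ZMod l // t ≠ 0}))
      (fun i => (⟨-O.ι i, neg_ne_zero.mpr (O.ne_zero i)⟩ : {t : ZMod l // t ≠ 0}))) := by
  set g := Sum.elim (fun i => (⟨O.ι i, O.ne_zero i⟩ : {t : ZMod l // t ≠ 0}))
      (fun i => (⟨-O.ι i, neg_ne_zero.mpr (O.ne_zero i)⟩ : {t : ZMod l // t ≠ 0})) with hg
  have hsurj : Function.Surjective g := by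
    rintro ⟨t, ht⟩
    obtain ⟨i, hi | hi⟩ := O.covers t ht
    · exact ⟨Sum.inl i, Subtype.ext (by simp [hg, hi])⟩
    · exact ⟨Sum.inr i, Subtype.ext (by simp [hg, hi])⟩
  refine (Fintype.bijective_iff_surjective_and_card g).mpr ⟨hsurj, le_antisymm ?_ (Fintype.card_le_of_surjective g hsurj)⟩
  -- `#(Fin l⋆ ⊕ Fin l⋆) = 2·⌊(l−1)/2⌋ ≤ l − 1 = #{t ≠ 0}`
  have hcard : Fintype.card {t : ZMod l // t ≠ 0} = l - 1 := by
    rw [Fintype.card_subtype, Finset.filter_ne', Finset.card_erase_of_mem (Finset.mem_univ _), Finset.card_univ, ZMod.card]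
  rw [Fintype.card_sum, Fintype.card_fin, hcard]
  omega

/-- **(γ) `V4B_inertEven l O` HOLDS for every orientation `O`** (L5-t8's A4 `Prop`, ★ p541424; sheet V4B §0 INERTNESS LEMMA «with print's EVEN value law … every cell
column at −t equals the column at t … E(ν;T) = E(ν̄;T) … G_oriented(T) = G(T) on every datum (0 new cells)»): for any weights `ν` on the residues and any EVEN column
`col (−t) = col t`, the oriented sum over `ZMod l ∖ 0` of `ν t·col t` equals the half sum along `O` with the pushed-forward weights `ν(ι i) + ν(−ι i)` — orientation
alone is count-neutral. [folklore] -/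
theorem V4B_inertEven_holds (O : OrientedLabels l) : V4B_inertEven l O := by
  intro ν col hcol
  rw [Finset.sum_subtype ((Finset.univ : Finset (ZMod l)).filter (fun t => t ≠ 0)) (p := fun t : ZMod l => t ≠ 0)
    (fun t => by simp) (fun t => ν t * col t)]
  rw [← (orientedCover_bijective O).sum_comp (fun x : {t : ZMod l // t ≠ 0} => ν x * col x), Fintype.sum_sum_type]
  simp only [Sum.elim_inl, Sum.elim_inr, hcol, add_mul]
  rw [Finset.sum_add_distrib]

/-- **(γ) … hence every `ν`-functional of an even column on the oriented labels is a functional of the PUSHED-FORWARD law alone**: two weight functions with the same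
`ν(ι i) + ν(−ι i)` along `O` give the same oriented sum (client 1's E-quotients, K_ν, M_ν, E_ν[j+1] are such sums — V4B (c) C1 «the G-table at G = 1 … = tst-2's V4 table
BY NAME»). [folklore] -/
theorem orientedSum_eq_of_pushforward_eq (O : OrientedLabels l) (col : ZMod l → ℝ) (hcol : ∀ t, col (-t) = col t) {ν ν' : ZMod l → ℝ}
    (h : ∀ i, ν (O.ι i) + ν (-O.ι i) = ν' (O.ι i) + ν' (-O.ι i)) :
    ∑ t ∈ (Finset.univ : Finset (ZMod l)).filter (fun t => t ≠ 0), ν t * col t =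
      ∑ t ∈ (Finset.univ : Finset (ZMod l)).filter (fun t => t ≠ 0), ν' t * col t := by
  rw [V4B_inertEven_holds O ν col hcol, V4B_inertEven_holds O ν' col hcol]
  exact Finset.sum_congr rfl fun i _ => by rw [h i]

end Inert

/-! ## §V4B (α). The top-label law's constant BY NAME -/

section Top

variable {n : ℕ}

/-- **(α) `C(LabelLaw.top, l) = 2l/(l⋆−1)`** (`= 4l/(l−3)` at `l = 2l⋆+1`, the FENCE minimum `CellWeights.topConstant_eq`): L5-t8's top-label law `δ_{l⋆}` (★ p541424, the
law of `V4B_measureResidual`'s door) is supported on the top label, so part 1's `lawConstant_of_top` applies. [folklore] -/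
theorem lawConstant_top (hn : 2 ≤ n) (h0 : 0 < n) (l : ℕ) : lawConstant l (LabelLaw.top h0) = 2 * (l : ℝ) / ((n : ℝ) - 1) :=
  lawConstant_of_top hn l (LabelLaw.top h0) fun i hi => by
    show (if (i : ℕ) + 1 = n then (1 : ℝ) else 0) = 0
    rw [if_neg hi]

/-- … and it is the MINIMUM over all laws with positive gap side (part 1's `topConstant_le_lawConstant`): `C(LabelLaw.top, l) ≤ C(ν, l)`. [folklore] -/
theorem lawConstant_top_le (hn : 2 ≤ n) (h0 : 0 < n) (l : ℕ) (L : LabelLaw n) (hgap : 0 < ∑ i : Fin n, L.ν i * ((((i : ℕ) : ℝ) + 1) ^ 2 - 1)) :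
    lawConstant l (LabelLaw.top h0) ≤ lawConstant l L := by
  rw [lawConstant_top hn h0 l]
  exact topConstant_le_lawConstant hn l L hgap

end Top

/-! ## §V4B (β). A6 at the trivial group: the orbit count, the free action, and the reduction to the synchronisation clause -/

section ConjSync

variable {n : ℕ}

/-- The trivial label symmetry has EXACTLY `n` orbits on `n` labels (every orbit a singleton): L5-t8's `HasOrbitCount ⊥ (Fin n) n` HOLDS. [folklore] -/
theorem hasOrbitCount_bot (n : ℕ) : HasOrbitCount (↥(⊥ : Subgroup (Equiv.Perm (Fin n)))) (Fin n) n := by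
  unfold HasOrbitCount
  have hbij : Function.Bijective
      (Quotient.mk (MulAction.orbitRel (↥(⊥ : Subgroup (Equiv.Perm (Fin n)))) (Fin n)) : Fin n → _) := by
    refine ⟨fun x y hxy => ?_, fun q => Quotient.exists_rep q⟩
    have hrel := Quotient.exact hxy
    obtain ⟨g, hg⟩ := MulAction.orbitRel_apply.1 hrel
    have hg1 : (g : Equiv.Perm (Fin n)) = 1 := Subgroup.mem_bot.mp g.2
    have hg' : (g : Equiv.Perm (Fin n)) • y = x := hg
    rw [hg1, one_smul] at hg'
    exact hg'.symm
  rw [← Nat.card_eq_of_bijective _ hbij, Nat.card_eq_fintype_card, Fintype.card_fin]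

/-- Every stabiliser of the trivial label symmetry is trivial (the action is FREE — «each orbit a torsor»). [folklore] -/
theorem stabilizer_bot_eq_bot (x : Fin n) : MulAction.stabilizer (↥(⊥ : Subgroup (Equiv.Perm (Fin n)))) x = ⊥ :=
  (Subgroup.eq_bot_iff_forall _).mpr fun g _ => Subsingleton.elim g 1

/-- **(β) A6 REDUCED TO ITS CLAUSE: `V4B_conjSyncWithoutPM n ConjSync ↔ 2 ≤ n ∧ ConjSync`** (sheet V4B (a) A6 «`V4_B5_reqM2` … with the group argument specialised to ⊥ —
which makes its synchronisation clause the whole content»; L5-t8's A6, ★ p541424): at the trivial group the orbit-count, `2 ≤ r`, free-action and comparison-network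
conjuncts of PART B's `V4_B5_reqM2` are `HasOrbitCount ⊥ (Fin n) n` (PROVED), `2 ≤ n`, trivial stabilisers (PROVED) and `True`; what remains is the PARAMETER `ConjSync`
(conjugate synchronisation without `±` — prose in the sheet; nothing here inhabits it). [claim: Mochizuki2012, status: disputed] -/
theorem V4B_conjSyncWithoutPM_iff (n : ℕ) (ConjSync : Prop) : V4B_conjSyncWithoutPM n ConjSync ↔ 2 ≤ n ∧ ConjSync := by
  unfold V4B_conjSyncWithoutPM V4_B5_reqM2
  exact ⟨fun ⟨_, h2, _, _, hC⟩ => ⟨h2, hC⟩, fun ⟨h2, hC⟩ => ⟨hasOrbitCount_bot n, h2, stabilizer_bot_eq_bot, trivial, hC⟩⟩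

/-- **(β) … and such an indexing escapes the M2 forcing lemma** (part 1's `not_isPretransitive_of_reqM2` at A6): `V4B_conjSyncWithoutPM n ConjSync ⟹` the trivial
symmetry is NOT pretransitive on the `n ≥ 2` labels — M2 (`LabelLaw.isUniform_of_symmetricUnder`) imposes nothing; M1 (`V4_B4_reqM1`) is untouched. [folklore] -/
theorem not_isPretransitive_of_conjSyncWithoutPM {ConjSync : Prop} (h : V4B_conjSyncWithoutPM n ConjSync) :
    ¬ MulAction.IsPretransitive (↥(⊥ : Subgroup (Equiv.Perm (Fin n)))) (Fin n) :=
  not_isPretransitive_of_reqM2 h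

end ConjSync

end Summit.ABC.IUTFork.Repair.RH.Round4ConstraintFacesEven

end
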